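import Summits.QuantumFields.YangMills.Theses.DirichletWindow
import Literature.MathematicalPhysics.QuantumLattice.LatticeGaugeDLRLimitPointsProofs

/-!
# `CriticalityOfXiDiverges`: `ξ(β) → ∞` forces every admissible clustering rate to `0`

Closes item stmt-QuantumFields-12318 of route `DirichletWindow` (sub-problem `YangMills`): the glue
`XiDiverges → (criticality hypothesis of CriticalContinuumLimit)`.

**Statement.** Assume `XiDiverges`: for every compact simple `G`, every lattice representation `r` and
every `ε > 0` there is `β₁(ε)` such that for `β ≥ β₁(ε)` EVERY infinite-volume torus-limit state
`μ ∈ infiniteVolumeLimitPoints r.ρ β` has `A e^{-m n} ≤ f_β(n e₀)` for all `n`, with `A > 0`,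
`0 ≤ m ≤ ε` (`f_β = plaquetteCorrFn r.ρ μ`, Chatterjee's plaquette–plaquette correlation). Then for
every compact simple `G` (Borel structure from the topology), every `r`, `β₁` and rate function `m` with,
for all `β ≥ β₁`, `m(β) > 0` and a volume threshold `S₀` and constants `C(A, B)` such that
`|⟨A · τₙ B⟩_{β,2S+1} − ⟨A⟩⟨B⟩| ≤ C e^{−m(β) n}` for all `YMSpecies A, B`, all `S ≥ S₀`, `n ≤ S`
(`latticeConnectedCorr`), one has `m(β) → 0`, i.e. `∀ m₀ > 0, ∀ᶠ β, m(β) < m₀`.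

**Proof** (as planned in the route file). Fix `m₀ > 0` and `β ≥ max(β₁, β₁(m₀/2))`; suppose
`m(β) ≥ m₀`.
1. `exists_isInfiniteVolumeLimitAlong_odd`: the torus Wilson states along the ODD sides `2S+1`
   have a subsequential limit `μ` (compactness of the space of probability measures on the compact
   metrisable `G^{edges(ℤ⁴)}`, exactly as the tree's `infiniteVolumeLimitPoints_nonempty_holds`), so
   `μ ∈ infiniteVolumeLimitPoints r.ρ β` along `L_k + 1 = 2 φ(k) + 1`.
2. `plaquetteCorrFn_le_of_abs_latticeConnectedCorr_le`: the single `(0,1)`-plaquette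
   `P = Re tr r.ρ(U_{p₀})` is a `YMSpecies` (tree `plaquetteObservable`); on the torus of side `2S+1`,
   `latticeConnectedCorr r.ρ β (2S+1) P P n = ⟨P · P_{n e₀}⟩ − ⟨P⟩⟨P_{n e₀}⟩` (the shifted plaquette
   `P ∘ θ_{−n e₀} = P_{n e₀}` and translation invariance of the torus state,
   `wilsonExpectation_comp_torusConfigShift`), and the three torus expectations converge along the odd
   tori to the `μ`-integrals (bounded continuous cylinder observables), whence
   `f_β(n e₀) ≤ C e^{−m(β) n}` for every `n`.
3. `XiDiverges` at `ε = m₀/2` gives `A' e^{−m' n} ≤ f_β(n e₀)` with `m' ≤ m₀/2 < m₀ ≤ m(β)`; the two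
   exponential rates are incompatible as `n → ∞` (`false_of_exp_lower_le_upper`).

Sources: E. Seiler, LNP 159 (1982) Ch. 2 (infinite-volume limit by compactness, translation
invariance); K. Osterwalder, E. Seiler, Ann. Phys. 110 (1978) §2 (transfer matrix / time correlations);
S. Chatterjee, arXiv:1803.01950, Problem 5.1 (`f_β`, `ξ(β)`).
-/

noncomputable section

open MeasureTheory Filter Topology
open Literature.MathematicalPhysics.QuantumFieldTheory
open Literature.MathematicalPhysics.QuantumLattice

namespace Summit.QuantumFields.YangMills.Theorems

namespace CriticalityOfXiDiverges

section Shift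

variable {d N : ℕ} {G : Type} [Group G] [MeasurableSpace G] (ρ : G →* Matrix (Fin N) (Fin N) ℂ)

-- adapted from `Literature.Barriers.QuantumFields.plaquetteObs_configShift`
-- (Literature/Barriers/QuantumFields/AbelianDeconfinementD4Proofs.lean), restated to keep imports small
/-- Plaquette observables of a translated configuration: `O_{(x;i,j)} (θ_v U) = O_{(x−v;i,j)} U`
(`configShift v U e = U (e.1 − v, e.2)`). [folklore] -/
theorem plaquetteObs_configShift (v x : Literature.Probability.LatticeModels.Site d) (i j : Fin d)
    (U : LGConfig d G) :
    plaquetteObs ρ x i j (configShift v U) = plaquetteObs ρ (x - v) i j U := by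
  simp only [plaquetteObs, plaquetteHolonomyZd, configShift_apply, add_sub_right_comm]

end Shift

section Rates

/-- **Two exponential rates are incompatible.** If `A e^{−m n} ≤ C e^{−M n}` for all `n : ℕ` with
`A > 0` and `m < M`, contradiction: `A ≤ C e^{−(M−m) n} → 0`. [folklore] -/
theorem false_of_exp_lower_le_upper {A C m M : ℝ} (hA : 0 < A) (hmM : m < M)
    (h : ∀ n : ℕ, A * Real.exp (-(m * n)) ≤ C * Real.exp (-(M * n))) : False := by
  have hδ : 0 < M - m := sub_pos.2 hmM
  have ht : Tendsto (fun n : ℕ => C * Real.exp (-((M - m) * n))) atTop (𝓝 (C * 0)) :=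
    (Real.tendsto_exp_neg_atTop_nhds_zero.comp
      ((tendsto_natCast_atTop_atTop (R := ℝ)).const_mul_atTop hδ)).const_mul C
  rw [mul_zero] at ht
  obtain ⟨n, hn⟩ := (ht.eventually (eventually_lt_nhds hA)).exists
  have h2 : A ≤ C * Real.exp (-((M - m) * n)) := by
    have h1 := h n
    have hpos : 0 < Real.exp (m * n) := Real.exp_pos _
    have key : A = A * Real.exp (-(m * n)) * Real.exp (m * n) := by
      rw [mul_assoc, ← Real.exp_add, neg_add_cancel, Real.exp_zero, mul_one]
    have key2 : C * Real.exp (-((M - m) * n)) = C * Real.exp (-(M * n)) * Real.exp (m * n) := by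
      rw [mul_assoc, ← Real.exp_add]
      congr 2
      ring
    rw [key, key2]
    exact mul_le_mul_of_nonneg_right h1 hpos.le
  exact absurd h2 (not_le.2 hn)

end Rates

section Limits

variable {d N : ℕ} {G : Type} [Group G] [TopologicalSpace G] [IsTopologicalGroup G]
  [CompactSpace G] [MeasurableSpace G] [BorelSpace G] (ρ : G →* Matrix (Fin N) (Fin N) ℂ)

-- adapted from `Literature.MathematicalPhysics.QuantumLattice.infiniteVolumeLimitPoints_nonempty_holds`
-- (Literature/MathematicalPhysics/QuantumLattice/LatticeGaugeDLRLimitPointsProofs.lean): same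
-- compactness argument, run on the odd tori only
/-- **A limit point along the odd tori.** For a continuous representation `ρ` of the compact
second-countable Hausdorff group `G` and every `β`, the torus Wilson states on the tori of ODD side
`2S+1` have a subsequence `S = φ(k)` converging on all bounded continuous cylinder observables to a
probability measure `μ` on `G^{edges(ℤ^d)}`: `IsInfiniteVolumeLimitAlong ρ β (2φ) μ` (torus sizes
`2φ(k) + 1`). The space of probability measures on the compact metrisable `G^{edges(ℤ^d)}` is compact
and metrisable, and weak convergence is convergence of integrals of bounded continuous functions
(Seiler LNP 159 Ch. 2; Chatterjee arXiv:1803.01950 §2). [folklore] -/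
theorem exists_isInfiniteVolumeLimitAlong_odd [T2Space G] [SecondCountableTopology G]
    (hρ : Continuous ρ) (β : ℝ) :
    ∃ (μ : Measure (LGConfig d G)) (φ : ℕ → ℕ), StrictMono φ ∧
      IsInfiniteVolumeLimitAlong (d := d) ρ β (fun k => 2 * φ k) μ := by
  haveI := fun S : ℕ => isProbabilityMeasure_torusState (d := d) (L := 2 * S + 1) ρ hρ β
  let P : ℕ → ProbabilityMeasure (LGConfig d G) := fun S =>
    ⟨torusState ρ β (2 * S + 1), inferInstance⟩
  obtain ⟨μ, -, φ, hφ, hlim⟩ :=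
    (isCompact_univ (X := ProbabilityMeasure (LGConfig d G))).tendsto_subseq
      fun n => Set.mem_univ (P n)
  refine ⟨(μ : Measure (LGConfig d G)), φ, hφ, inferInstance, fun F S _ hFc hFb => ?_⟩
  obtain ⟨C, hC⟩ := hFb
  let Fb : BoundedContinuousFunction (LGConfig d G) ℝ :=
    BoundedContinuousFunction.ofNormedAddCommGroup F hFc C
      (fun U => by simpa [Real.norm_eq_abs] using hC U)
  have hE : (fun k : ℕ =>
      wilsonExpectation (L := 2 * φ k + 1) ρ β (toTorusObservable (2 * φ k + 1) F)) =
      fun k => ∫ U, Fb U ∂(P (φ k) : Measure (LGConfig d G)) :=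
    funext fun k => wilsonExpectation_toTorusObservable ρ β (2 * φ k + 1) hFc.measurable
  have key : Tendsto (fun k : ℕ => ∫ U, Fb U ∂(P (φ k) : Measure (LGConfig d G))) atTop
      (𝓝 (∫ U, Fb U ∂(μ : Measure (LGConfig d G)))) :=
    (ProbabilityMeasure.tendsto_iff_forall_integral_tendsto.1 hlim) Fb
  show Tendsto (fun k : ℕ =>
      wilsonExpectation (L := 2 * φ k + 1) ρ β (toTorusObservable (2 * φ k + 1) F)) atTop _
  rw [hE]
  exact key

/-- **Torus clustering bounds pass to an odd-torus limit state.** Let `μ` be the limit of the torus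
Wilson states along the odd sides `2φ(k)+1` and let `P = Re tr ρ(U_{p₀})` be the `(0,1)`-plaquette at
the origin. If `|latticeConnectedCorr ρ β (2S+1) P P n| ≤ b` for all `S ≥ S₀` with `n ≤ S`, then
`plaquetteCorrFn ρ μ (n e₀) ≤ b`. Indeed `latticeConnectedCorr ρ β (2S+1) P P n =
⟨P · P_{n e₀}⟩_{2S+1} − ⟨P⟩_{2S+1}⟨P_{n e₀}⟩_{2S+1}` (the shifted plaquette `P ∘ θ_{−n e₀}` is the
plaquette at `n e₀`, and `⟨P_{n e₀}⟩ = ⟨P⟩` by translation invariance of the torus state), and the three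
torus expectations of these bounded continuous cylinder observables converge to the `μ`-integrals
along `S = φ(k) → ∞` (Seiler LNP 159 Ch. 2). [folklore] -/
theorem plaquetteCorrFn_le_of_abs_latticeConnectedCorr_le (hρ : Continuous ρ) {β : ℝ}
    {μ : Measure (LGConfig 4 G)} {φ : ℕ → ℕ} (hφ : StrictMono φ)
    (hμ : IsInfiniteVolumeLimitAlong (d := 4) ρ β (fun k => 2 * φ k) μ) {S₀ n : ℕ} {b : ℝ}
    (hb : ∀ S : ℕ, S₀ ≤ S → n ≤ S →
      |latticeConnectedCorr ρ β (2 * S + 1) (plaquetteObs ρ 0 0 1) (plaquetteObs ρ 0 0 1) n| ≤ b) :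
    plaquetteCorrFn ρ μ ((n : ℤ) • Pi.single (0 : Fin 4) (1 : ℤ)) ≤ b := by
  -- notation: the separation `x = n e₀`, the plaquettes at `0` and at `x`
  set x : Literature.Probability.LatticeModels.Site 4 := (n : ℤ) • Pi.single (0 : Fin 4) (1 : ℤ)
    with hx
  set P : LGConfig 4 G → ℝ := plaquetteObs ρ 0 0 1 with hP
  set Px : LGConfig 4 G → ℝ := plaquetteObs ρ x 0 1 with hPx
  have h01 : ((0 : Fin 4), (1 : Fin 4)).1 < ((0 : Fin 4), (1 : Fin 4)).2 := by decide
  -- regularity of the two plaquette observables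
  have hPc : Continuous P := continuous_plaquetteObs (d := 4) ρ hρ 0 0 1
  have hPxc : Continuous Px := continuous_plaquetteObs (d := 4) ρ hρ x 0 1
  obtain ⟨CP, hCP⟩ :=
    exists_abs_plaquetteObs_le (d := 4) ρ hρ (0 : Literature.Probability.LatticeModels.Site 4) 0 1
  obtain ⟨CPx, hCPx⟩ := exists_abs_plaquetteObs_le (d := 4) ρ hρ x 0 1
  have hPcyl : IsCylinder P (plaquetteEdges
      ((0 : Literature.Probability.LatticeModels.Site 4), ⟨((0 : Fin 4), (1 : Fin 4)), h01⟩)) :=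
    isCylinder_plaquetteObs (d := 4) ρ
      ((0 : Literature.Probability.LatticeModels.Site 4), ⟨((0 : Fin 4), (1 : Fin 4)), h01⟩)
  have hPxcyl : IsCylinder Px (plaquetteEdges (x, ⟨((0 : Fin 4), (1 : Fin 4)), h01⟩)) :=
    isCylinder_plaquetteObs (d := 4) ρ (x, ⟨((0 : Fin 4), (1 : Fin 4)), h01⟩)
  obtain ⟨-, hconv⟩ := hμ
  -- the three torus expectations converge along the odd tori `2 φ k + 1`
  have t1 := hconv (fun U => P U * Px U) _ (IsCylinder.mul hPcyl hPxcyl) (hPc.mul hPxc)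
    ⟨CP * CPx, fun U => by
      show |P U * Px U| ≤ CP * CPx
      rw [abs_mul]
      exact mul_le_mul (hCP U) (hCPx U) (abs_nonneg _) ((abs_nonneg _).trans (hCP U))⟩
  have t2 := hconv P _ hPcyl hPc ⟨CP, hCP⟩
  have t3 := hconv Px _ hPxcyl hPxc ⟨CPx, hCPx⟩
  have hlim : Tendsto (fun k : ℕ =>
      wilsonExpectation (L := 2 * φ k + 1) ρ β
          (toTorusObservable (2 * φ k + 1) fun U => P U * Px U) -
        wilsonExpectation (L := 2 * φ k + 1) ρ β (toTorusObservable (2 * φ k + 1) P) *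
          wilsonExpectation (L := 2 * φ k + 1) ρ β (toTorusObservable (2 * φ k + 1) Px))
      atTop (𝓝 ((∫ U, P U * Px U ∂μ) - (∫ U, P U ∂μ) * ∫ U, Px U ∂μ)) :=
    t1.sub (t2.mul t3)
  -- the shifted plaquette: `P ∘ θ_{-n e₀} = Px`
  have hv : (0 : Literature.Probability.LatticeModels.Site 4) - -Pi.single (0 : Fin 4) (n : ℤ) = x := by
    rw [zero_sub, neg_neg, hx]
    ext i
    by_cases hi : i = 0
    · subst hi
      simp
    · simp [hi]
  have hshift : ∀ V : LGConfig 4 G, P (configShift (-Pi.single (0 : Fin 4) (n : ℤ)) V) = Px V := by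
    intro V
    rw [hP, hPx, plaquetteObs_configShift, hv]
  have hPx_eq : Px = P ∘ configShift (-Pi.single (0 : Fin 4) (n : ℤ)) :=
    funext fun V => (hshift V).symm
  -- identification of `latticeConnectedCorr` with the torus truncated correlation of `P`, `Px`
  have hT : ∀ S : ℕ, latticeConnectedCorr ρ β (2 * S + 1) P P n =
      wilsonExpectation (L := 2 * S + 1) ρ β (toTorusObservable (2 * S + 1) fun U => P U * Px U) -
        wilsonExpectation (L := 2 * S + 1) ρ β (toTorusObservable (2 * S + 1) P) *
          wilsonExpectation (L := 2 * S + 1) ρ β (toTorusObservable (2 * S + 1) Px) := by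
    intro S
    have hW : wilsonExpectation (L := 2 * S + 1) ρ β (toTorusObservable (2 * S + 1) Px) =
        wilsonExpectation (L := 2 * S + 1) ρ β (toTorusObservable (2 * S + 1) P) := by
      rw [hPx_eq, toTorusObservable_comp_configShift, wilsonExpectation_comp_torusConfigShift]
    rw [hW]
    simp only [latticeConnectedCorr, wilsonExpectation, toTorusObservable_apply, hshift]
  -- the bound holds eventually along the subsequence, hence in the limit
  have hev : ∀ᶠ k : ℕ in atTop,
      wilsonExpectation (L := 2 * φ k + 1) ρ β
          (toTorusObservable (2 * φ k + 1) fun U => P U * Px U) -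
        wilsonExpectation (L := 2 * φ k + 1) ρ β (toTorusObservable (2 * φ k + 1) P) *
          wilsonExpectation (L := 2 * φ k + 1) ρ β (toTorusObservable (2 * φ k + 1) Px) ≤ b := by
    refine eventually_atTop.2 ⟨max S₀ n, fun k hk => ?_⟩
    have hk' : k ≤ φ k := hφ.le_apply
    rw [← hT]
    exact (le_abs_self _).trans (hb (φ k) ((le_max_left _ _).trans (hk.trans hk'))
      ((le_max_right _ _).trans (hk.trans hk')))
  exact le_of_tendsto hlim hev

end Limits

end CriticalityOfXiDiverges

open CriticalityOfXiDiverges in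
/-- **Item stmt-QuantumFields-12318 (`CriticalityOfXiDiverges`, route `DirichletWindow`), proved.**
`XiDiverges` — every torus-limit state at large `β` has `f_β(n e₀) ≥ A e^{−m n}` with `m ≤ ε` — implies
the criticality clause of `CriticalContinuumLimit`: every admissible volume-uniform clustering rate
`m(β)` of the `(2S+1)`-tori at Wilson coupling `β` (all `YMSpecies`, `S ≥ S₀(β)`, `n ≤ S`) tends to `0`
as `β → ∞`. Proof: the single `(0,1)`-plaquette is a `YMSpecies` (`plaquetteObservable`); at
`β ≥ max(β₁, β₁(m₀/2))` a limit point `μ` of the torus states along the odd sides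
(`exists_isInfiniteVolumeLimitAlong_odd`) has `f_β(n e₀) ≤ C e^{−m(β) n}` for all `n`
(`plaquetteCorrFn_le_of_abs_latticeConnectedCorr_le`), while `XiDiverges` gives
`A' e^{−m' n} ≤ f_β(n e₀)` with `m' ≤ m₀/2`; hence `m(β) < m₀` (`false_of_exp_lower_le_upper`).
[folklore] -/
theorem criticalityOfXiDiverges_proof :
    Summit.QuantumFields.YangMills.Theses.DirichletWindow.CriticalityOfXiDiverges := by
  intro hXi G _ _ _ _ hG
  letI : MeasurableSpace G := borel G
  haveI : BorelSpace G := ⟨rfl⟩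
  intro r β₁ m hclust m₀ hm₀
  haveI : SecondCountableTopology G :=
    (r.continuous.isClosedEmbedding r.injective).isEmbedding.secondCountableTopology
  haveI : T2Space G := (r.continuous.isClosedEmbedding r.injective).isEmbedding.t2Space
  obtain ⟨β₂, hβ₂⟩ := hXi G hG r (m₀ / 2) (half_pos hm₀)
  filter_upwards [eventually_ge_atTop (max β₁ β₂)] with β hβ
  by_contra hnot
  rw [not_lt] at hnot
  obtain ⟨-, S₀, hS₀⟩ := hclust β ((le_max_left _ _).trans hβ)
  obtain ⟨C, hC⟩ := hS₀ (plaquetteObservable (d := 4) r.ρ r.continuous 0 1)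
    (plaquetteObservable (d := 4) r.ρ r.continuous 0 1)
  obtain ⟨μ, φ, hφ, hμ⟩ := exists_isInfiniteVolumeLimitAlong_odd (d := 4) r.ρ r.continuous β
  have hμmem : μ ∈ infiniteVolumeLimitPoints (d := 4) r.ρ β :=
    ⟨fun k => 2 * φ k, fun _ _ hab => by dsimp only; have := hφ hab; omega, hμ⟩
  obtain ⟨m', A', hA', -, hm'le, hlow⟩ := hβ₂ β ((le_max_right _ _).trans hβ) μ hμmem
  have hup : ∀ n : ℕ, plaquetteCorrFn r.ρ μ ((n : ℤ) • Pi.single (0 : Fin 4) (1 : ℤ)) ≤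
      C * Real.exp (-(m β * n)) := fun n =>
    plaquetteCorrFn_le_of_abs_latticeConnectedCorr_le r.ρ r.continuous hφ hμ
      (fun S hS hn => hC S n hS hn)
  exact false_of_exp_lower_le_upper hA' (by linarith) fun n => (hlow n).trans (hup n)

end Summit.QuantumFields.YangMills.Theorems

end
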